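import Summits.QuantumFields.BalabanUV.Beta.SpineRecursiveT2StepComb
import Summits.QuantumFields.BalabanUV.Beta.CombChartResolventRules
import Summits.QuantumFields.BalabanUV.Beta.SecondOrderSymContact

/-!
# `BalabanUV.Beta.SpineRecursiveWLawComb` — binder row D1, RULING R-D1-g35-1 (chart (III′)), brick P6-3: **THE W-LAW OF THE SLOTTED W-TABLES AT THE COMB-CHART RESOLVENTS
# FROM (hT2-rem) + (hM2) + (hsplit)** — the (III′) twin of `SpineRecursiveWLawSym` (gen 31): `WrecOf_bref_of_T2RM_comb`, same wiring over `SecondOrderSymContact`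
# with `Gsym ↦ GcombSh` (reflection invariance `CombChartResolventRules.refK_coDressKAt_Gsym`, spread `spr_GcombSh`), `Dsh ↦ Dsh Lc`

HONEST FRAMING (cell charter, verbatim): «discharging BetaPertH makes Bałaban's UV stability UNCONDITIONAL — a real constructive-QFT result; it is
NOT the continuum limit and NOT the Clay problem.»  HONEST DEPENDENCY: continuum YM on T⁴ ⇐ BetaPertH ∧ nine spine estimates (0/9 proved); BetaPertH
⇐ (D1) ∧ (D4) ∧ CAP+tail; G-an2-4 gates asym, D1 and NE2/3/4.  DERIVED cell leaf (wiring, [folklore]; β sub-cell, row-D1 OWNER `b2b-balaban-beta-an2` gen 36, programme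
P6); no statement of Bałaban's papers, no `[cite:]`, no `def`, no `Prop` fact; EVERY table LETTER IS A HYPOTHESIS; instantiates no binder of the wall.  RECORD = ROOT M′
p303989 (chart (II)) unchanged.  NOT D1, NOT `BetaPertH`, NOT continuum, NOT Clay.
Provenance: β sub-cell, unit beta-an2 gen 36, 2026-08-22 (v1); text of `SpineRecursiveWLawSym` transformed by name; no existing file touched.
-/

open Finset
open scoped BigOperators
open Literature.MathematicalPhysics.QuantumFieldTheory
open Literature.MathematicalPhysics.QuantumFieldTheory.Balaban1983to89
open Literature.MathematicalPhysics.QuantumFieldTheory.Balaban1983to89.Beta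
open ExpKernelCalculus (MKer Decays BiLoc comp VertexFamily)
open PolarizationSign (reflSign)
open KernelReflection (refK)
open ResolventReflection (bref Φ)
open OneStepResolventKernel (Fib LocStencil)
open OneStepKernelFamily (KInvStep colH)
open BalabanStepJetsSucc (wVH)
open BalabanStepW2 (M2Of)
open SecondOrderResponse (dM W2OfK W2SymOfK)
open Summit.QuantumFields.BalabanUV.Beta.TameKernelCalculus
open Summit.QuantumFields.BalabanUV.Beta.ChartConjugation (conjV conjW)
open Summit.QuantumFields.BalabanUV.Beta.BorderedHessian (bhK diagK stepScale)
open Summit.QuantumFields.BalabanUV.Beta.CombChartStepJets (GcombSh GcombSh_apply)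
open Summit.QuantumFields.BalabanUV.Beta.DshAn1 (Dsh)
open Summit.QuantumFields.BalabanUV.Beta.SymShiftedSpread (bhKStepSh)
open Summit.QuantumFields.BalabanUV.Beta.E3ContactGenerator (ctGenM)
open Summit.QuantumFields.BalabanUV.Beta.CombChartResolventRules (refK_coDressKAt_Gsym)
open Summit.QuantumFields.BalabanUV.Beta.CombChartContactFactor (spr_GcombSh)
open Summit.QuantumFields.BalabanUV.Beta.ReflectionLocusSymPure (M1Of_bref)
open Summit.QuantumFields.BalabanUV.Beta.SecondOrderTransport (W2SymOfK_bref_sharp)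
open Summit.QuantumFields.BalabanUV.Beta.SecondOrderSymContact (W2SymOfK_sharp_split_of)

noncomputable section

namespace Summit.QuantumFields.BalabanUV.Beta.SpineRooted

section WLawComb

variable {d Lc : ℕ} [NeZero Lc]

/-- [folklore] **THE W-LAW OF THE SLOTTED W-TABLE AT THE SYMMETRISED RESOLVENTS FROM (hT2-rem), (hM2-rem), (hsplit), (hDg)** (see the module docstring). -/
theorem WrecOf_bref_of_T2RM_comb (hLc : Odd Lc)
    {V H : Fin (d + 1) → (Fin (d + 1) → ℤ) → MKer (d + 1) (Fib d)}
    (hHr : ∀ (α μ : Fin (d + 1)) (y : Fin (d + 1) → ℤ), H μ (bref α μ y) = reflSign α μ • refK (Φ (d := d) Lc α) (H μ y))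
    (cE cVH cΛ cE₂ cB : ℝ) (T : Fin 4 → Fin 4 → Fin 4 → Fin 4 → ℝ)
    (vh₂S mixFF : Fin (d + 1) → (Fin (d + 1) → ℤ) → Fin (d + 1) → (Fin (d + 1) → ℤ) → MKer (d + 1) (Fib d))
    (γ : ℕ → ℝ) (j : ℕ) (α : Fin (d + 1))
    (hSp : ∀ κ u, SpureRecOf d Lc V H (GcombSh Lc) cE cVH cΛ j κ (bref α κ u) = reflSign α κ • refK (Φ Lc α)
      (SpureRecOf d Lc V H (GcombSh Lc) cE cVH cΛ j κ u + conjV (bhKStepSh d Lc (Dsh Lc) j) (diagK fun p c => γ j * ctGenM d (bhK Lc + Dsh Lc) α Lc κ u p c)))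
    (h : Fin (d + 1) → (Fin (d + 1) → ℤ) → Fin (d + 1) → (Fin (d + 1) → ℤ) → (Fin (d + 1) → ℤ) → Fib d → ℝ)
    (R2 : Fin (d + 1) → (Fin (d + 1) → ℤ) → Fin (d + 1) → (Fin (d + 1) → ℤ) → MKer (d + 1) (Fib d))
    (RM : Fin (d + 1) → (Fin (d + 1) → ℤ) → Fin (d + 1) → (Fin (d + 1) → ℤ) → MKer (d + 1) (Fib d))
    (hT2 : ∀ (κ : Fin (d + 1)) (u : Fin (d + 1) → ℤ) (κ' : Fin (d + 1)) (u' : Fin (d + 1) → ℤ),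
      T2RecOf d Lc (GcombSh Lc) (SpureRecOf d Lc V H (GcombSh Lc) cE cVH cΛ) (M1Of d Lc H cΛ) cE₂ cB T vh₂S mixFF j κ (bref α κ u) κ' (bref α κ' u') =
        (reflSign α κ * reflSign α κ') • refK (Φ Lc α)
          (T2RecOf d Lc (GcombSh Lc) (SpureRecOf d Lc V H (GcombSh Lc) cE cVH cΛ) (M1Of d Lc H cΛ) cE₂ cB T vh₂S mixFF j κ u κ' u' +
            conjW (bhKStepSh d Lc (Dsh Lc) j)
              (SpureRecOf d Lc V H (GcombSh Lc) cE cVH cΛ j κ u) (SpureRecOf d Lc V H (GcombSh Lc) cE cVH cΛ j κ' u')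
              (diagK fun p c => γ j * ctGenM d (bhK Lc + Dsh Lc) α Lc κ u p c) (diagK fun p c => γ j * ctGenM d (bhK Lc + Dsh Lc) α Lc κ' u' p c)
              (diagK (h κ u κ' u')) +
            R2 κ u κ' u'))
    (hM2 : ∀ (κ : Fin (d + 1)) (u : Fin (d + 1) → ℤ) (ρ : Fin (d + 1)) (w : Fin (d + 1) → ℤ),
      M2Of d Lc mixFF j κ (bref α κ u) ρ (bref α ρ w) =
        (reflSign α κ * reflSign α ρ) • refK (Φ Lc α)
          (M2Of d Lc mixFF j κ u ρ w + conjV (M1Of d Lc H cΛ j ρ w) (diagK fun p c => γ j * ctGenM d (bhK Lc + Dsh Lc) α Lc κ u p c) + RM κ u ρ w))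
    (X2s : Fin (d + 1) → (Fin (d + 1) → ℤ) → Fin (d + 1) → (Fin (d + 1) → ℤ) → (Fin (d + 1) → ℤ) → Fib d → ℝ)
    (Δ : Fin (d + 1) → (Fin (d + 1) → ℤ) → Fin (d + 1) → (Fin (d + 1) → ℤ) → MKer (d + 1) (Fib d))
    (hsplit : ∀ (μ : Fin (d + 1)) (y : Fin (d + 1) → ℤ) (ν : Fin (d + 1)) (y' : Fin (d + 1) → ℤ),
      W2OfK (GcombSh (d := d) Lc j) Lc
          (fun κ u => SpureRecOf d Lc V H (GcombSh Lc) cE cVH cΛ j κ u +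
            conjV (bhKStepSh d Lc (Dsh Lc) j) (diagK fun p c => γ j * ctGenM d (bhK Lc + Dsh Lc) α Lc κ u p c))
          (M1Of d Lc H cΛ j)
          (fun κ u κ' u' => T2RecOf d Lc (GcombSh Lc) (SpureRecOf d Lc V H (GcombSh Lc) cE cVH cΛ) (M1Of d Lc H cΛ) cE₂ cB T vh₂S mixFF j κ u κ' u' +
            conjW (bhKStepSh d Lc (Dsh Lc) j)
              (SpureRecOf d Lc V H (GcombSh Lc) cE cVH cΛ j κ u) (SpureRecOf d Lc V H (GcombSh Lc) cE cVH cΛ j κ' u')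
              (diagK fun p c => γ j * ctGenM d (bhK Lc + Dsh Lc) α Lc κ u p c) (diagK fun p c => γ j * ctGenM d (bhK Lc + Dsh Lc) α Lc κ' u' p c)
              (diagK (h κ u κ' u')) +
            R2 κ u κ' u')
          (fun κ u ρ w => M2Of d Lc mixFF j κ u ρ w + conjV (M1Of d Lc H cΛ j ρ w) (diagK fun p c => γ j * ctGenM d (bhK Lc + Dsh Lc) α Lc κ u p c) +
            RM κ u ρ w)
          μ y ν y' =
        W2OfK (GcombSh (d := d) Lc j) Lc (SpureRecOf d Lc V H (GcombSh Lc) cE cVH cΛ j) (M1Of d Lc H cΛ j)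
            (T2RecOf d Lc (GcombSh Lc) (SpureRecOf d Lc V H (GcombSh Lc) cE cVH cΛ) (M1Of d Lc H cΛ) cE₂ cB T vh₂S mixFF j) (M2Of d Lc mixFF j) μ y ν y' +
          conjW (bhKStepSh d Lc (Dsh Lc) j)
            (dM (GcombSh Lc j) Lc (SpureRecOf d Lc V H (GcombSh Lc) cE cVH cΛ j) (M1Of d Lc H cΛ j) μ y)
            (dM (GcombSh Lc j) Lc (SpureRecOf d Lc V H (GcombSh Lc) cE cVH cΛ j) (M1Of d Lc H cΛ j) ν y')
            (diagK fun p c => ∑ κ, ∑' u, colH (GcombSh Lc j) Lc μ y κ u * (γ j * ctGenM d (bhK Lc + Dsh Lc) α Lc κ u p c))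
            (diagK fun p c => ∑ κ, ∑' u, colH (GcombSh Lc j) Lc ν y' κ u * (γ j * ctGenM d (bhK Lc + Dsh Lc) α Lc κ u p c))
            (diagK (X2s μ y ν y')) +
          Δ μ y ν y')
    (hDg : ∀ (ν : Fin (d + 1)) (y' : Fin (d + 1) → ℤ),
      Loc (dM (GcombSh (d := d) Lc j) Lc
        (fun κ u => SpureRecOf d Lc V H (GcombSh Lc) cE cVH cΛ j κ u +
          conjV (bhKStepSh d Lc (Dsh Lc) j) (diagK fun p c => γ j * ctGenM d (bhK Lc + Dsh Lc) α Lc κ u p c))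
        (M1Of d Lc H cΛ j) ν y'))
    (μ : Fin (d + 1)) (y : Fin (d + 1) → ℤ) (ν : Fin (d + 1)) (y' : Fin (d + 1) → ℤ) :
    WrecOf d Lc (GcombSh Lc) (SpureRecOf d Lc V H (GcombSh Lc) cE cVH cΛ) (M1Of d Lc H cΛ) cE₂ cB T vh₂S mixFF j μ (bref α μ y) ν (bref α ν y') =
      (reflSign α μ * reflSign α ν) • refK (Φ Lc α)
        (WrecOf d Lc (GcombSh Lc) (SpureRecOf d Lc V H (GcombSh Lc) cE cVH cΛ) (M1Of d Lc H cΛ) cE₂ cB T vh₂S mixFF j μ y ν y' +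
          conjW (bhKStepSh d Lc (Dsh Lc) j)
            (dM (GcombSh Lc j) Lc (SpureRecOf d Lc V H (GcombSh Lc) cE cVH cΛ j) (M1Of d Lc H cΛ j) μ y)
            (dM (GcombSh Lc j) Lc (SpureRecOf d Lc V H (GcombSh Lc) cE cVH cΛ j) (M1Of d Lc H cΛ j) ν y')
            (diagK fun p c => ∑ κ, ∑' u, colH (GcombSh Lc j) Lc μ y κ u * (γ j * ctGenM d (bhK Lc + Dsh Lc) α Lc κ u p c))
            (diagK fun p c => ∑ κ, ∑' u, colH (GcombSh Lc j) Lc ν y' κ u * (γ j * ctGenM d (bhK Lc + Dsh Lc) α Lc κ u p c))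
            (diagK (X2s μ y ν y')) +
          ((1 / 2 : ℝ) • conjV (bhKStepSh d Lc (Dsh Lc) j) (diagK fun p a => X2s ν y' μ y p a - X2s μ y ν y' p a) +
            (1 / 2 : ℝ) • (Δ μ y ν y' + Δ ν y' μ y))) := by
  have hKr : refK (Φ (d := d) Lc α) (GcombSh (d := d) Lc j) = GcombSh Lc j := by rw [GcombSh_apply]; exact refK_coDressKAt_Gsym hLc j α
  have hMr : ∀ (ρ : Fin (d + 1)) (w : Fin (d + 1) → ℤ),
      M1Of d Lc H cΛ j ρ (bref α ρ w) = reflSign α ρ • refK (Φ Lc α) (M1Of d Lc H cΛ j ρ w) := fun ρ w => M1Of_bref hHr cΛ j α ρ w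
  rw [WrecOf_eq, W2SymOfK_bref_sharp hKr (spr_GcombSh j) hSp hMr hT2 hM2 hDg μ y ν y', W2SymOfK_sharp_split_of (hsplit μ y ν y') (hsplit ν y' μ y)]

end WLawComb

end Summit.QuantumFields.BalabanUV.Beta.SpineRooted

end
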